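import Mathlib
import HarnessLib
import Summits.ABC.ABC.Theses.CongruentialReceptacle
import Summits.ABC.ABC.Theorems.CongruentialReceptacleReceptacleIdentityStableSzpiroDefs
import Summits.ABC.ABC.Theorems.CongruentialReceptacleReceptacleIdentityStubStableSzpiroOfTLR
import Summits.ABC.ABC.Theorems.ReceptacleIdentity.Negative.TameLocalReceptacleResidueFree
import Summits.ABC.ABC.Theorems.ReceptacleIdentity.Negative.TameLocalReceptacleFalseOfNearMatchedFreeLunch
import Summits.ABC.ABC.Theorems.ReceptacleIdentity.Negative.StableSzpiroMatchedRateLaw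

/-!
# Line `split-friable-margin` — an UNCONDITIONAL analytic design line for crux `ReceptacleIdentity`
# (stmt-ABC-1813), registered (like the live line) against the typed target
# `Summit.ABC.ABC.Theorems.StableSzpiro.NotTameLocalReceptacle := ¬ TameLocalReceptacle`

Crux-strategist s2 (planner-cstrat-stmt-ABC-1813-s2-0, 2026-08-17), alternative line; it does NOT
touch the live skeleton `Lines/stable_szpiro_duality.lean` (one open stub `stub_matchedFreeLunch`,
verdict LINE-DEAD by lead c2) and reuses its landed reduction (Defs p133899, A1 p134656).

## The lever (why this dodges the stuck goal `∃ κ ε, MatchedFreeLunch κ ε`)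

Every template hunt died at the same place: a residue-MATCHED certificate needs, class by class at
every data prime, supply ≥ demand, and for every generator tried the last `O(β)` of the junk mass
could not be matched (strategist s1's "law of 12" for split families, position-B starvation for
S-unit pigeonholing, c2's legs 1–3), while the one arithmetic generator left needs CLASS-LEVEL
friable equidistribution = the sibling crux's GRH engine.  Four changes give the switch teeth:

1. ASYMMETRIC SCHEMA.  In the box inequality behind Stable Szpiro an UNCOVERED negative datum costs
   `c₁'(v+1) log p` (adversarial `c₁'`), but an OVER-supplied junk datum costs only the fixed
   `c₁(6+ε−2v) log p` — it sits inside the gain functional.  So a design may run a uniform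
   OVER-SUPPLY MARGIN `δ₀ ≍ β/24` (negatives' total weight scaled down): every class-count
   mismatch below `δ₀` becomes cheap over-supply, and only a FIXED relative precision `δ₀` of the
   class counts is needed (not `o(1)` asymptotics), outside an exceptional set of data primes of
   bounded `Σ log q / q` (bounded defect, absorbed by the `∃ K ∀ C` clause).  Real-weight schema:
   `NearMatchedFreeLunchR` below; `notTLR_of_nearMatchedR` is PROVED here from A1.
2. SPLIT + FRIABLE ON BOTH SIDES.  Triples come from the Plücker/cross-ratio identity
   `x(x+s+t) + st = (x+s)(x+t)` (all members products of LINEAR factors of the parameters), with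
   positives AND negatives restricted to parameters whose six factors are `y`-friable,
   `y = N^{1/4}/(log N)^B`: no large-prime data at all (s1's top range is gone), no granularity
   (supply per class `≥ N^{3−β}/q³ → ∞`), and `a + b = c` holds identically — NO additive problem in
   friable numbers is ever solved (this is where it parts from the sibling's wall N3).
3. SYMMETRISED CARRIERS.  Position-wise mass conservation kills every single-carrier design (cost
   `(8+2ε)β` against gain `2β`); three positive types of equal weight — `2^V ∣ x` in the order
   `(xw, st, C)`, the same numbers in the order `(st, xw, C)`, and `2^V ∣ x+t` — supply
   `P(2 − β/3) log N` in EACH position, so `W⁻ = P(1−β/6)/(1+δ₀)` balances all three.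
4. TILT FLATTENING.  The only systematic supply/demand law mismatch is the Dickman tilt between a
   carrier cofactor of size `N^{1−β}` and a plain factor of size `N` (`|log ratio| ≤ C β v log q/log N`);
   ADDITIVE weights `h = 1 + Σ_{q^v ∥ member} c(q^v)` on negatives (`Σ c = O(β)`, bounded because the
   tilt is log-proportional) remove it at main term, using class counts with ONE extra exact
   prime-power condition.

Economics (ε = 1, κ = 1/16, margin `δ₀ = O(β²)`): gain `≈ 2β(1 − O(β)) log N · P`, `‖F‖₁ ≈ 2P`,
defect `O(log log N) · ‖F‖₁`, ratio → ∞; `β` must be tiny (`≤ ρ(4)⁵/6400`) but fixed.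

## Where the analysis really sits (honest)

Class counts at a data prime `q ∣ x` contain 4-point parallelogram patterns of the friable indicator
RESTRICTED TO PROGRESSIONS mod `q` (lags `qk` from pairing, `qx′` from the Plücker shift); L²
information (large sieve, Barban–Davenport–Halberstam) provably does not suffice.  The minimal input
is U²/sup Fourier-uniformity of `1_friable − model` ALONG progressions mod `q` for most `q ≤ y`, all
residues; with `y = N^{1/4−o(1)}` a number `≤ 3N` has at most four primes `> y`, the Legendre
expansion `1_fr = Σ_k (−1)^k N_k` is finite, and the input becomes a Bombieri–Vinogradov theorem for
prime exponential sums with `max` over residues and `sup` over minor-arc twists at LEVEL 1/4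
(`BVExpLevelQuarter`, in bilinear form) plus the classical BV/Siegel–Walfisz/Vinogradov theorems that the tree
already PROVES (`bombieri_vinogradov_holds`, `siegel_walfisz_holds`, `norm_primeSum_vinogradov`).
Level 1/4 (not 1/2) because the q-adic major arcs `α ≈ c/(r′q²)` are discharged by BV (max over
residues) at moduli `r′q² ≤ x^{1/2−o(1)}`; a second, plain bilinear BV at level 1/2 (`BilinearBVHalf`)
serves the classical major arcs inside progressions and the carrier classes (moduli `q·2^V ≤ N^{1/4+β}`).
The Dickman input is `FriableLocalLaw` (Ψ(Z,y) ~ Zρ(u) uniformly for 1 ≤ u ≤ 8).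

## Stubs (5 sorried + 1 proved; hardest: `stub_classControl_of_inputs`; deepest input: `stub_bvExpLevelQuarter`)

* `stub_nearMatchedR_of_classControl : PlueckerClassControl → NearMatchedFreeLunchR (1/16) 1` — the
  design (family, three carrier types in two orderings, margin, additive tilt weights, certificate
  bookkeeping).  XL, elementary given the class-control numbers.
* `stub_classControl_of_inputs : BVExpLevelQuarter → BilinearBVHalf → FriableLocalLaw →
  PlueckerClassControl` — the analytic bookkeeping: finite Legendre expansion, generalized von Neumann
  for the complexity-1 Plücker system in AP-index coordinates (bounded coefficients), removal of the `x′`-dependence of the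
  class map by a COMPLETE quadratic character sum (`Σ_ρ χ((u²−4ρa²)(u²−4ρb²)) = O(1)`), exceptional
  moduli from the BV-type averages.  XL.
* `stub_bvExpLevelQuarter` — Vaughan's identity + progression-coupled type II estimate + the tree's BV
  (max over residues) for the q-adic major arcs; plausibly in print (Liu–Zhan / Halupczok-type mixed
  mean values).  L–XL.
* `stub_bilinearBVHalf` — Iwaniec–Kowalski Thm 17.4 + classical BV.  L.
* `stub_friableLocalLaw` — Dickman–de Bruijn–Hildebrand.  L.
* `notTLR_of_nearMatchedR` — PROVED below (no sorry): the real-weight `o(gain)` near-matched schema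
  refutes the typed crux through A1.

Composition `NotTameLocalReceptacle_of` is kernel-checked.  Disproof.lean honoured: F1 (residue-free,
landed `…Negative/TameLocalReceptacleResidueFree`, imported) — our families are residue-AWARE; F2
(averaging cannot refute) — this is ONE signed family matched class by class, not an averaged
certificate; F4 (lower window is the content) — the gain functional is the lower window; F5
(near-matched schema p134085, imported) — `NearMatchedFreeLunchR` is its real-weight form through A1;
F7(i) rate law (p134855, imported) — respected: positives out-weigh negatives in mass by exactly the
`2^V` mass; F7(iii)/F9 (S-unit ceiling; "design needs friable equidistribution") — the design IS a
friable design, but in a SPLIT family where the needed equidistribution is BV-type at level 1/4, not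
the sibling's circle method.  `ledger negatives --problem ABC` (stmt-ABC-1205, stmt-ABC-1689):
unrelated.
-/

-- `Summit.<Summit>.<Problem>`: for the single-conjunct summit `ABC` the two coincide (CONVENTIONS §2).
set_option linter.dupNamespace false

namespace Summit.ABC.ABC.Cruxes.ReceptacleIdentity.SplitFriableMargin

open Literature.NumberTheory.DiophantineGeometry (IsABCTriple rad)
open Summit.ABC.ABC.Theses.CongruentialReceptacle
open Summit.ABC.ABC.Theorems.StableSzpiro
open Finset Filter

noncomputable section

open scoped Classical

/-! ### 1. The real-weight near-matched schema (asymmetric: over-supply is cheap, deficits are not) -/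

variable {κ : ℝ}

/-- The gain functional at `c₁ = 1`: `Σ_d (∂F d)⁺ · (2v − 6 − ε) log p` over the POSITIVE boundary
(junk data `v ≤ 2` enter with their negative sign: over-supply is charged here, at the fixed rate). -/
def gainR (ε : ℝ) (F : SignedFamily κ) : ℝ :=
  F.bdry.sum fun d m => max m 0 * ((2 * ((d.i + d.j + d.k : ℕ) : ℝ) - 6 - ε) * Real.log d.p)

/-- The defect functional at `c₁' = 1`: `Σ_d (∂F d)⁻ · (v + 1) log p` over the NEGATIVE boundary. -/
def defectR (F : SignedFamily κ) : ℝ :=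
  F.bdry.sum fun d m => max (-m) 0 * ((((d.i + d.j + d.k : ℕ) : ℝ) + 1) * Real.log d.p)

/-- **Real-weight near-matched free lunch at `(κ, ε)`** (the `o(gain)` form): for EVERY defect price `K`
and every `C` a signed family with `C ‖F‖₁ + K · defect < gain`.  (`MatchedFreeLunch` is the case of zero
defect; the landed integer schema `NearMatchedFreeLunch` of p134085 is the special case `defect ≤ K₀‖F‖₁`
with one `K₀`.  The design below has defect `O(log log N) · ‖F‖₁` against gain `≍ β log N · ‖F‖₁`, which is
why the `∀ K` form is the one registered.) -/
def NearMatchedFreeLunchR (κ ε : ℝ) : Prop :=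
  ∀ K C : ℝ, ∃ F : SignedFamily κ, C * F.l1 + K * defectR F < gainR ε F

/-- The box functional splits as `Φ = c₁ · gain − c₁' · defect` (definitional bookkeeping). [folklore] -/
theorem Phi_eq_gainR_sub_defectR (c₁ c₁' ε : ℝ) (F : SignedFamily κ) :
    Phi c₁ c₁' ε F.bdry = c₁ * gainR ε F - c₁' * defectR F := by
  simp only [Phi, gainR, defectR, lowerW, upperW, Finsupp.sum, Finset.mul_sum,
    ← Finset.sum_sub_distrib]
  refine Finset.sum_congr rfl fun d _ => ?_
  ring

/-- The defect is non-negative (`log p ≥ 0` for a natural `p`). [folklore] -/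
theorem defectR_nonneg (F : SignedFamily κ) : 0 ≤ defectR F := by
  simp only [defectR, Finsupp.sum]
  refine Finset.sum_nonneg fun d _ => ?_
  refine mul_nonneg (le_max_right _ _) (mul_nonneg ?_ (Real.log_natCast_nonneg d.p))
  positivity

/-- `‖F‖₁ ≥ 0`. [folklore] -/
theorem l1_nonneg (F : SignedFamily κ) : 0 ≤ F.l1 :=
  Finset.sum_nonneg fun _ _ => abs_nonneg _

/-- **The real-weight near-matched schema refutes the typed crux** (PROVED; uses the landed stub A1
`stub_stableSzpiroAt_of_tameLocalReceptacleAt`, p134656): a near-matched free lunch at ONE `(κ, ε)`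
beats every `(c₁, c₁', c₃)` — take `K = |c₁'|/c₁`, `C = |c₃|/c₁ + 1`. [folklore] -/
theorem notTLR_of_nearMatchedR :
    ∀ κ ε : ℝ, 0 < κ → 0 < ε → NearMatchedFreeLunchR κ ε → ¬ TameLocalReceptacle := by
  intro κ ε hκ hε h hT
  obtain ⟨c₁, c₁', c₃, hc₁, hSS⟩ :=
    stub_stableSzpiroAt_of_tameLocalReceptacleAt κ ε (tameLocalReceptacle_iff.mp hT κ hκ ε hε)
  obtain ⟨F, hF⟩ := h (|c₁'| / c₁) (|c₃| / c₁ + 1)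
  have hPhi : Phi c₁ c₁' ε F.bdry ≤ c₃ * F.l1 := hSS F
  rw [Phi_eq_gainR_sub_defectR] at hPhi
  have hD : 0 ≤ defectR F := defectR_nonneg F
  have hl : 0 ≤ F.l1 := l1_nonneg F
  have h1 : c₁' * defectR F ≤ |c₁'| * defectR F :=
    mul_le_mul_of_nonneg_right (le_abs_self _) hD
  have h4 : c₃ * F.l1 ≤ |c₃| * F.l1 := mul_le_mul_of_nonneg_right (le_abs_self _) hl
  have hmul : c₁ * ((|c₃| / c₁ + 1) * F.l1 + |c₁'| / c₁ * defectR F) < c₁ * gainR ε F :=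
    mul_lt_mul_of_pos_left hF hc₁
  have hc₁ne : c₁ ≠ 0 := ne_of_gt hc₁
  have hcanc₁ : c₁ * (|c₃| / c₁) = |c₃| := mul_div_cancel₀ _ hc₁ne
  have hcanc₂ : c₁ * (|c₁'| / c₁) = |c₁'| := mul_div_cancel₀ _ hc₁ne
  have hC : c₁ * ((|c₃| / c₁ + 1) * F.l1 + |c₁'| / c₁ * defectR F) =
      |c₃| * F.l1 + c₁ * F.l1 + |c₁'| * defectR F := by
    linear_combination F.l1 * hcanc₁ + defectR F * hcanc₂
  have h6 : 0 ≤ c₁ * F.l1 := mul_nonneg hc₁.le hl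
  nlinarith [h1, h4, hmul, hC, h6, hPhi]

/-! ### 2. The split-friable Plücker populations -/

/-- `n` is `y`-friable: every prime factor is `≤ y`. -/
def Friable (y : ℝ) (n : ℕ) : Prop := ∀ p ∈ n.primeFactors, (p : ℝ) ≤ y

/-- The six linear factors `x, s, t, x+s, x+t, x+s+t` of a parameter triple `(x, s, t)`. -/
def plFactors (P : ℕ × ℕ × ℕ) : List ℕ :=
  [P.1, P.2.1, P.2.2, P.1 + P.2.1, P.1 + P.2.2, P.1 + P.2.1 + P.2.2]

/-- The Plücker triple `(A, B, C) = (x(x+s+t), st, (x+s)(x+t))`. -/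
def plTriple (P : ℕ × ℕ × ℕ) : ℕ × ℕ × ℕ :=
  (P.1 * (P.1 + P.2.1 + P.2.2), P.2.1 * P.2.2, (P.1 + P.2.1) * (P.1 + P.2.2))

/-- The same triple in the order `(B, A, C)` (used by the design for the position-b carriers). -/
def plTripleSwap (P : ℕ × ℕ × ℕ) : ℕ × ℕ × ℕ :=
  (P.2.1 * P.2.2, P.1 * (P.1 + P.2.1 + P.2.2), (P.1 + P.2.1) * (P.1 + P.2.2))

/-- The cross-ratio identity: every Plücker triple satisfies `A + B = C`. [folklore] -/
theorem plTriple_sum (P : ℕ × ℕ × ℕ) : (plTriple P).1 + (plTriple P).2.1 = (plTriple P).2.2 := by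
  simp only [plTriple]
  ring

/-- Admissible parameters: the box `(N/2, N]³`, the four coprimalities that make `(A, B)` coprime,
and `y`-friability of all six factors. -/
def PlAdmissible (N : ℕ) (y : ℝ) (P : ℕ × ℕ × ℕ) : Prop :=
  (N / 2 < P.1 ∧ P.1 ≤ N) ∧ (N / 2 < P.2.1 ∧ P.2.1 ≤ N) ∧ (N / 2 < P.2.2 ∧ P.2.2 ≤ N) ∧
  Nat.Coprime P.1 P.2.1 ∧ Nat.Coprime P.1 P.2.2 ∧
  Nat.Coprime (P.1 + P.2.1 + P.2.2) P.2.1 ∧ Nat.Coprime (P.1 + P.2.1 + P.2.2) P.2.2 ∧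
  ∀ f ∈ plFactors P, Friable y f

/-- The parameter box. -/
def plBox (N : ℕ) : Finset (ℕ × ℕ × ℕ) := (Icc 1 N) ×ˢ ((Icc 1 N) ×ˢ (Icc 1 N))

/-- NEGATIVES: all-odd admissible parameters (then `C = (x+s)(x+t)` is the even member). -/
def negPop (N : ℕ) (y : ℝ) : Finset (ℕ × ℕ × ℕ) :=
  (plBox N).filter fun P => PlAdmissible N y P ∧ Odd P.1 ∧ Odd P.2.1 ∧ Odd P.2.2

/-- TYPE-A POSITIVES: `2^V ∣ x` (carrier in the member `A = x(x+s+t)`; in the swapped order the same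
numbers carry in position b). -/
def posAPop (N V : ℕ) (y : ℝ) : Finset (ℕ × ℕ × ℕ) :=
  (plBox N).filter fun P => PlAdmissible N y P ∧ 2 ^ V ∣ P.1 ∧ Odd P.2.1 ∧ Odd P.2.2

/-- TYPE-C POSITIVES: all odd and `2^V ∣ x + t` (carrier in the member `C = (x+s)(x+t)`). -/
def posCPop (N V : ℕ) (y : ℝ) : Finset (ℕ × ℕ × ℕ) :=
  (plBox N).filter fun P => PlAdmissible N y P ∧ Odd P.1 ∧ Odd P.2.1 ∧ Odd P.2.2 ∧ 2 ^ V ∣ P.1 + P.2.2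

/-- The three raw populations: `0` negatives, `1` type A, `2` type C. -/
def pop (N V : ℕ) (y : ℝ) : Fin 3 → Finset (ℕ × ℕ × ℕ) :=
  ![negPop N y, posAPop N V y, posCPop N V y]

/-- The member of an ordered triple in position `pos`. -/
def member (T : ℕ × ℕ × ℕ) (pos : Fin 3) : ℕ := ![T.1, T.2.1, T.2.2] pos

/-- Class count: parameters in `Ps` whose Plücker triple (order `tr`) has the datum `d` at `d.p`
(`datumAt` is the landed crux currency). -/
def classCount (Ps : Finset (ℕ × ℕ × ℕ)) (tr : ℕ × ℕ × ℕ → ℕ × ℕ × ℕ) (d : Datum) : ℕ :=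
  (Ps.filter fun P => d.p ∣ (tr P).1 * (tr P).2.1 * (tr P).2.2 ∧
      datumAt (tr P).1 (tr P).2.1 (tr P).2.2 d.p = d).card

/-- Class count with ONE extra condition `q' ∥ member_{pos'}` (valuation exactly one) at another prime — the
input of the additive tilt-flattening weights. -/
def classCount₂ (Ps : Finset (ℕ × ℕ × ℕ)) (tr : ℕ × ℕ × ℕ → ℕ × ℕ × ℕ) (d : Datum)
    (q' : ℕ) (pos' : Fin 3) : ℕ :=
  (Ps.filter fun P => (d.p ∣ (tr P).1 * (tr P).2.1 * (tr P).2.2 ∧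
      datumAt (tr P).1 (tr P).2.1 (tr P).2.2 d.p = d) ∧
      (member (tr P) pos').factorization q' = 1).card

/-- Admissible data of valuation ONE in position `pos` (the classes that can be inhabited: `(q−1)²` of
them per `(q, pos)`; coprimality forces the other two valuations to vanish and `a + b = c` forces one
residue).  Valuations `≥ 2` carry total mass `O(1)` per triple and are left unmatched by the design. -/
def AdmissibleDatum (d : Datum) (pos : Fin 3) : Prop :=
  (pos = 0 → d.i = 1 ∧ d.j = 0 ∧ d.k = 0 ∧ 1 ≤ d.r ∧ d.r < d.p ∧ 1 ≤ d.s ∧ d.s < d.p ∧ d.z = d.s) ∧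
  (pos = 1 → d.j = 1 ∧ d.i = 0 ∧ d.k = 0 ∧ 1 ≤ d.s ∧ d.s < d.p ∧ 1 ≤ d.r ∧ d.r < d.p ∧ d.z = d.r) ∧
  (pos = 2 → d.k = 1 ∧ d.i = 0 ∧ d.j = 0 ∧ 1 ≤ d.z ∧ d.z < d.p ∧ 1 ≤ d.r ∧ d.r < d.p ∧
    d.s = d.p - d.r)

/-- **Class control at scale `N`** for parameters `(β, δ, B, B', R₀, C₁, C₂)`, local laws `lam` and an
exceptional set of primes `E`.  Friability level `y = N^{1/4}/(log N)^B`; controlled data primes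
`q ∈ (R₀, y']`, `y' = N^{1/4}/(log N)^{B'}` (the sliver `(y', y]` is left to the defect: type II sums need
the large primes to exceed the modulus by a log power); 2-adic depth `V = ⌊β log N / log 2⌋`.
(CC0) the three populations are nonempty; (L1) the per-capita local laws `lam i q pos` (= proportion of
population `i` with `q ∥` the member in position `pos`) are positive and `≤ C₁/q`; (L2) TILT BOUND: each
positive type's law is the negatives' law up to `exp(±(C₂ β log q / log N + δ))` (Dickman tilt of a
carrier cofactor of size `N^{1−β}`; plain factors agree); (CC1) CLASS UNIFORMITY at every
non-exceptional controlled prime: every admissible class holds `lam · |pop| / (q−1)²` members up to the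
relative precision `δ`; (CC3) one extra condition `q' ∥ member_{pos'}` at another non-exceptional
controlled prime multiplies the class count by `lam i q' pos'`, up to `δ`. -/
def ClassControlAt (β δ B B' R₀ C₁ C₂ : ℝ) (N : ℕ) (lam : Fin 3 → ℕ → Fin 3 → ℝ)
    (E : Finset ℕ) : Prop :=
  let y : ℝ := (N : ℝ) ^ (1 / 4 : ℝ) / Real.log N ^ B
  let y' : ℝ := (N : ℝ) ^ (1 / 4 : ℝ) / Real.log N ^ B'
  let V : ℕ := ⌊β * Real.log N / Real.log 2⌋₊
  (∑ q ∈ E, Real.log q / q ≤ δ) ∧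
  (∀ i : Fin 3, (pop N V y i).Nonempty) ∧
  (∀ (i : Fin 3) (q : ℕ) (pos : Fin 3), q.Prime → R₀ < q → (q : ℝ) ≤ y' →
      0 < lam i q pos ∧ lam i q pos ≤ C₁ / (q : ℝ)) ∧
  (∀ (i : Fin 3) (q : ℕ) (pos : Fin 3), q.Prime → R₀ < q → (q : ℝ) ≤ y' →
      |Real.log (lam i q pos / lam 0 q pos)| ≤ C₂ * β * Real.log q / Real.log N + δ) ∧
  (∀ (i : Fin 3) (q : ℕ) (pos : Fin 3) (d : Datum), q.Prime → R₀ < q → (q : ℝ) ≤ y' → q ∉ E →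
      d.p = q → AdmissibleDatum d pos →
      |(classCount (pop N V y i) plTriple d : ℝ) - lam i q pos * (pop N V y i).card / ((q : ℝ) - 1) ^ 2|
        ≤ δ * (lam i q pos * (pop N V y i).card / ((q : ℝ) - 1) ^ 2)) ∧
  (∀ (i : Fin 3) (q : ℕ) (pos : Fin 3) (d : Datum) (q' : ℕ) (pos' : Fin 3),
      q.Prime → q'.Prime → q ≠ q' → R₀ < q → (q : ℝ) ≤ y' → q ∉ E → R₀ < q' → (q' : ℝ) ≤ y' →
      q' ∉ E → d.p = q → AdmissibleDatum d pos →
      |(classCount₂ (pop N V y i) plTriple d q' pos' : ℝ) -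
          lam i q pos * lam i q' pos' * (pop N V y i).card / ((q : ℝ) - 1) ^ 2|
        ≤ δ * (lam i q pos * lam i q' pos' * (pop N V y i).card / ((q : ℝ) - 1) ^ 2))

/-- **PLÜCKER CLASS CONTROL** (the analytic statement the design consumes): there are `β₀ > 0` and a
precision floor constant `C₃` such that for every `β ∈ (0, β₀)` and every precision `δ ≥ C₃ β²` (the
floor comes from the one term — four fluctuations at a carrier class — that needs progression-uniformity
at modulus `q · 2^V`, available only up to the large-prime cutoff, so an `8β`-fraction of the fluctuation
enters squared) there are `B, B', R₀, C₁, C₂` such that for all large `N` some local laws and some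
exceptional set of primes of log-mass `≤ δ` satisfy `ClassControlAt`. -/
def PlueckerClassControl : Prop :=
  ∃ β₀ C₃ : ℝ, 0 < β₀ ∧ 0 < C₃ ∧ ∀ β : ℝ, 0 < β → β < β₀ → ∀ δ : ℝ, C₃ * β ^ 2 ≤ δ →
    ∃ B B' R₀ C₁ C₂ : ℝ, ∀ᶠ N : ℕ in atTop,
      ∃ (lam : Fin 3 → ℕ → Fin 3 → ℝ) (E : Finset ℕ), ClassControlAt β δ B B' R₀ C₁ C₂ N lam E

/-! ### 3. The three analytic inputs -/

/-- `e(t) = exp(2π i t)`. -/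
def eAdd (t : ℝ) : ℂ := Complex.exp (2 * Real.pi * Complex.I * (t : ℂ))

/-- The progression-restricted, additively twisted bilinear form
`Σ_{m k ≤ X, m k ≡ a (q), k ≥ K₀} α_m Λ(k) e(φ m k)` — the non-friable part of a friable indicator restricted
to a progression is a bounded combination of these (finite Legendre expansion over the `≤ 4` primes `> y`). -/
def twistedBilinear (αc : ℕ → ℝ) (K₀ : ℝ) (q : ℕ) (a : ZMod q) (X φ : ℝ) : ℂ :=
  ∑ m ∈ Finset.Icc 1 ⌊X⌋₊, ∑ k ∈ Finset.Icc 1 ⌊X⌋₊,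
    if m * k ≤ ⌊X⌋₊ ∧ ((m * k : ℕ) : ZMod q) = a ∧ K₀ ≤ (k : ℝ) then
      ((αc m * ArithmeticFunction.vonMangoldt k : ℝ) : ℂ) * eAdd (φ * (m * k : ℕ))
    else 0

/-- Minor arc at height `x` and width parameter `P`: `α` has no rational approximation `b/r` with
`r ≤ P` within `P/(r x)` (Dirichlet then gives a denominator in `(P, x/P]`). -/
def IsMinorArc (x P α : ℝ) : Prop :=
  ∀ r : ℕ, 1 ≤ r → (r : ℝ) ≤ P → ∀ b : ℤ, P / ((r : ℝ) * x) < |α - (b : ℝ) / r|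

/-- **Bombieri–Vinogradov for progression-restricted prime exponential sums at level 1/4** (`max` over
residues, `sup` over minor-arc twists, bilinear form with a bounded smooth-side coefficient): for every
`A > 0` and cutoff exponent `B₀ ≥ 0` there are `B, D, C` such that for all large `x`, all coefficients
`|α_m| ≤ 1` supported on `m ≤ x^{3/4} (log x)^{B₀}`, all heights `X_q ≤ x`, all unit residues `a_q` and
all minor `φ_q`:  `Σ_{q ≤ x^{1/4}/log^B x} |Σ_{mk ≤ X_q, mk ≡ a_q (q), k ≥ x^{1/4}/log^{B₀} x} α_m Λ(k) e(φ_q mk)|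
≤ C x / log^A x`.  WHY TRUE (sketch, all ingredients tree theorems): Vaughan's identity on `k` with
`U = V = q log^c`, the coefficient `α_m` riding along; type I sums are geometric series over progressions;
the progression-coupled type II estimate `|S|² ≪ x log^c [x/(q²r′) + (K+M)/q + r′ log + 1]`
(`c/r′` a rational approximation of `φ q²`) needs both ranges in `[q log^c, x/(q log^c)]` — guaranteed by
the cutoffs; frequencies with `r′ < log^{2A+c}` are q-ADIC MAJOR ARCS `φ ≈ c/(r′q²)` where the main terms
cancel by Ramanujan orthogonality and the errors are `≤ r′q · max_ν |E(x; r′q², ν)|`, summed over `q` by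
the tree's PROVED `bombieri_vinogradov_holds` (max over residues) at moduli `r′q² ≤ x^{1/2}/log^B` —
which is what pins the level at `1/4`.  Literature: mixed mean values of this type occur in the
ternary-Goldbach-in-progressions line (Liu–Zhan 1997; Halupczok); the exact statement may need assembling. -/
def BVExpLevelQuarter : Prop :=
  ∀ A : ℝ, 0 < A → ∀ B₀ : ℝ, 0 ≤ B₀ → ∃ B D C : ℝ, ∀ᶠ x : ℝ in atTop,
    ∀ (αc : ℕ → ℝ) (X : ℕ → ℝ) (a : (q : ℕ) → ZMod q) (φ : ℕ → ℝ),
      (∀ m, |αc m| ≤ 1) → (∀ m : ℕ, x ^ (3 / 4 : ℝ) * Real.log x ^ B₀ < m → αc m = 0) →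
      (∀ q, X q ∈ Set.Icc 1 x) → (∀ q, IsUnit (a q)) → (∀ q, IsMinorArc x (Real.log x ^ D) (φ q)) →
        ∑ q ∈ Finset.Icc 1 ⌊x ^ (1 / 4 : ℝ) / Real.log x ^ B⌋₊,
            ‖twistedBilinear αc (x ^ (1 / 4 : ℝ) / Real.log x ^ B₀) q (a q) (X q) (φ q)‖ ≤
          C * x / Real.log x ^ A

/-- The untwisted progression-restricted bilinear form `Σ_{mk ≤ X, mk ≡ a (q), k ≥ K₀} α_m Λ(k)`. -/
def bilinearMod (αc : ℕ → ℝ) (K₀ : ℝ) (q : ℕ) (a : ZMod q) (X : ℝ) : ℝ :=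
  ∑ m ∈ Finset.Icc 1 ⌊X⌋₊, ∑ k ∈ Finset.Icc 1 ⌊X⌋₊,
    if m * k ≤ ⌊X⌋₊ ∧ ((m * k : ℕ) : ZMod q) = a ∧ K₀ ≤ (k : ℝ) then αc m * ArithmeticFunction.vonMangoldt k
    else 0

/-- Its expected value: `(1/φ(q)) Σ_{mk ≤ X, (mk, q) = 1, k ≥ K₀} α_m Λ(k)`. -/
def bilinearCoprime (αc : ℕ → ℝ) (K₀ : ℝ) (q : ℕ) (X : ℝ) : ℝ :=
  ∑ m ∈ Finset.Icc 1 ⌊X⌋₊, ∑ k ∈ Finset.Icc 1 ⌊X⌋₊,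
    if m * k ≤ ⌊X⌋₊ ∧ Nat.Coprime (m * k) q ∧ K₀ ≤ (k : ℝ) then αc m * ArithmeticFunction.vonMangoldt k
    else 0

/-- **Bilinear Bombieri–Vinogradov at level 1/2** (Iwaniec–Kowalski Thm 17.4 + the classical theorem for the
short-`m` range): same coefficients and cutoffs as above, no twist, `max` over residues, all heights `≤ x`,
moduli up to `x^{1/2}/log^B x`.  The design uses it at moduli `q·r ≤ x^{1/4+o(1)}` (classical major arcs
inside progressions) and `q · 2^V ≤ x^{1/4+β}` (carrier classes).  Tree: `bombieri_vinogradov_holds`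
(the case `α = δ₁`), `siegel_walfisz_holds`, `largeSieve_range` are PROVED. -/
def BilinearBVHalf : Prop :=
  ∀ A : ℝ, 0 < A → ∀ B₀ : ℝ, 0 ≤ B₀ → ∃ B C : ℝ, ∀ᶠ x : ℝ in atTop,
    ∀ (αc : ℕ → ℝ) (X : ℕ → ℝ),
      (∀ m, |αc m| ≤ 1) → (∀ m : ℕ, x ^ (3 / 4 : ℝ) * Real.log x ^ B₀ < m → αc m = 0) →
      (∀ q, X q ∈ Set.Icc 1 x) →
        ∑ q ∈ Finset.Icc 1 ⌊x ^ (1 / 2 : ℝ) / Real.log x ^ B⌋₊,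
            ⨆ a : (ZMod q)ˣ, |bilinearMod αc (x ^ (1 / 4 : ℝ) / Real.log x ^ B₀) q (a : ZMod q) (X q) -
              bilinearCoprime αc (x ^ (1 / 4 : ℝ) / Real.log x ^ B₀) q (X q) / Nat.totient q| ≤
          C * x / Real.log x ^ A

/-- `Ψ(X, y)` = the number of `y`-friable `n ∈ [1, X]`. -/
def Psi (X y : ℝ) : ℕ := ((Finset.Icc 1 ⌊X⌋₊).filter fun n => Friable y n).card

/-- **Friable local law** (Dickman–de Bruijn–Hildebrand): there is a positive function `ρ`,
log-Lipschitz on `[1, 8]`, with `Ψ(Z, y) = ρ(log Z / log y) · Z · (1 ± δ)` uniformly for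
`y ≤ Z ≤ y⁸`, for every `δ > 0` and `y ≥ y₀(δ)`.  (`ρ` = Dickman's function; Hildebrand 1986 gives the
asymptotic uniformly in far wider ranges; the tree has Hildebrand–Tenenbaum up to constants,
`card_smoothNumbersUpTo_two_sided`.)  Stated with `∃ ρ` so that no Dickman vocabulary is needed. -/
def FriableLocalLaw : Prop :=
  ∃ ρ : ℝ → ℝ, (∀ u ∈ Set.Icc (0 : ℝ) 8, 0 < ρ u) ∧
    (∃ Cρ : ℝ, ∀ u ∈ Set.Icc (1 : ℝ) 8, ∀ u' ∈ Set.Icc (1 : ℝ) 8,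
        |Real.log (ρ u) - Real.log (ρ u')| ≤ Cρ * |u - u'|) ∧
    ∀ δ : ℝ, 0 < δ → ∀ᶠ y : ℝ in atTop, ∀ Z : ℝ, y ≤ Z → Z ≤ y ^ (8 : ℕ) →
      |(Psi Z y : ℝ) - ρ (Real.log Z / Real.log y) * Z| ≤ δ * (ρ (Real.log Z / Real.log y) * Z)

/-! ### 4. Registered stubs -/

/-- **Stub (THE DESIGN; XL, elementary given the numbers).**  From class control: take `β₀, C₃`, fix
`β = min(β₀/2, 1/(10⁴ C₃), 10⁻³)`, `δ = C₃β²`, margin `δ₀ = 4δ`; for every `(K, C)` and `N` large build the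
signed family of `1/16`-balanced Plücker triples — positives of the three carrier types with equal total
weight (type B = type A through `plTripleSwap`; `min(A,B)/C > 1/16` on the box; `IsABCTriple` from the
four coprimalities and `plTriple_sum`), negatives = `negPop` with weights
`θ · (1 + Σ_{pos} Σ_{q ∥ member_pos} c(q, pos))`, `Σ |c| = O(β)` (additive tilt flattening from (L2), (CC3)) —
and read off: gain `≥ [2β − 30(δ₀ + 2δ)] log N · P − O_β(1)·P` (2-adic carriers at rate 2; over-supply
inside the gain functional at the fixed rate; classes `v ≥ 2`, exceptional and freed primes bounded),
defect `≤ O(log log N + log R₀)·‖F‖₁` (the sliver `(y', y]`, 2-adic data of negatives, freed primes),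
`‖F‖₁ ≤ 2P`; since gain/‖F‖₁ `≍ β log N` dominates `C + K·O(log log N)`, `NearMatchedFreeLunchR (1/16) 1`.
WHY IT MIGHT FAIL: a hidden term in the position-wise mass bookkeeping (checked by hand: supply
`P(2 − β/3) log N` per position, `W⁻ = P(1 − β/6)/(1 + δ₀)`), or the first-order additive weights leaving
a mismatch above the margin — then iterate the correction once more (the system is triangular). -/
theorem stub_nearMatchedR_of_classControl :
    PlueckerClassControl → NearMatchedFreeLunchR (1 / 16) 1 := by
  sorry

/-- **Stub (ANALYTIC BOOKKEEPING; XL, the hardest).**  From the three inputs (+ the tree's PROVED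
`bombieri_vinogradov_holds`, `siegel_walfisz_holds`, `norm_primeSum_vinogradov`) derive class control:
(a) `1_fr(n) = Σ_{d ∣ n, p ∣ d ⇒ p > y} μ(d)`, finite since `n ≤ 3N` has at most four primes `> y = N^{1/4−o(1)}`;
split `d ≤ x/(q log^c)` (the cofactor is a FREE variable: geometric sums) from `d > x/(q log^c)` (then
`d = p · d′` with `p ≥ y`: the bilinear forms of the two BV inputs, `α` supported on `m = n/p ≤ x^{3/4}log^{B₀}`);
(b) along every progression mod a good `q ≤ y'`, the fluctuation `1_fr − model` is U²-small: minor arcs by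
`BVExpLevelQuarter`, classical major arcs `b/r`, `r ≤ log^D`, by `BilinearBVHalf` at modulus `q r` plus the
`O(log r / log N)` bias of friables mod `r`; (c) class counts of VALUATION-ONE data in progression-index
coordinates `(x′, i, j)` are averages of the complexity-1 Plücker system `{x′, i, j, x′+i, x′+j, x′+i+j}`
with bounded coefficients — generalized von Neumann (two Cauchy–Schwarz); for the carrier types the shift
variable is dilated by `D = 2^V` (`= N^β`): two-fluctuation terms are the variance of the fluctuation over
classes mod `qD ≤ N^{1/4+β}` (`BilinearBVHalf`), the four-fluctuation term needs sup-uniformity at modulus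
`qD`, available up to the cutoff only — the `8β`-fraction of the fluctuation carried by primes in
`[y, qD log^c)` is bounded trivially and enters squared: precision floor `C₃β²`; (d) the class map depends
on `x′ mod q` only through a quadratic character, removed by the COMPLETE sum
`Σ_ρ χ((u² − 4ρa²)(u² − 4ρb²)) = O(1)` using only positivity of fibre sizes and their equidistribution over
`x′ mod q` (Cauchy–Schwarz restriction of the global L²-fluctuation bound: `√(q/N)`-gain); (e) laws, tilt
(L2) and (CC3) from `FriableLocalLaw` and pairwise independence of the six forms mod every prime;
(f) exceptional primes = moduli where the BV-type averages are large (`#E ∩ [R,2R] ≤ R log^{−A}`).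
WHY IT MIGHT FAIL: (b) on major arcs inside progressions must keep the secondary (non-smooth) main terms of
friables mod small `r` below `δ`; (c) the counting lemma with functions on different progressions and one
interval, and the trivial treatment of the `8β`-fraction, must really close at `C₃β²`. -/
theorem stub_classControl_of_inputs :
    BVExpLevelQuarter → BilinearBVHalf → FriableLocalLaw → PlueckerClassControl := by
  sorry

/-- **Stub (ANALYTIC INPUT; L–XL).** See the docstring of `BVExpLevelQuarter`.  WHY IT MIGHT FAIL: only through
the q-adic major arcs — if moduli `r′q²` cannot all be pushed under `x^{1/2}/log^B` with the log powers as
quantified, the provable level is `1/4 − o(1)`; the line survives any fixed level `θ₀ > 0` (re-site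
`y = N^{θ₀−o(1)}`: still finitely many large primes per number). -/
theorem stub_bvExpLevelQuarter : BVExpLevelQuarter := by
  sorry

/-- **Stub (ANALYTIC INPUT; L).** See the docstring of `BilinearBVHalf` (Iwaniec–Kowalski Thm 17.4 for
`m ≥ log^{2A}`, the tree's `bombieri_vinogradov_holds` for `m < log^{2A}`; heights below `x log^{−A−2}` are
trivial).  WHY IT MIGHT FAIL: not expected to. -/
theorem stub_bilinearBVHalf : BilinearBVHalf := by
  sorry

/-- **Stub (ANALYTIC INPUT; L).** See the docstring of `FriableLocalLaw` (Dickman 1930, de Bruijn 1951,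
Hildebrand 1986 Thm 1).  WHY IT MIGHT FAIL: not expected to; the log-Lipschitz clause holds with
`Cρ = 4` since `|ρ′/ρ| = ρ(u−1)/(uρ(u)) ≤ 4` on `[1, 8]`. -/
theorem stub_friableLocalLaw : FriableLocalLaw := by
  sorry

/-! ### 5. Composition (kernel-checked; no sorry of its own) -/

/-- **The composition, hypotheses form** (sorry-free, standard axioms). [folklore] -/
theorem notTameLocalReceptacle_of_stubs
    (h₁ : ∀ κ ε : ℝ, 0 < κ → 0 < ε → NearMatchedFreeLunchR κ ε → ¬ TameLocalReceptacle)
    (h₂ : PlueckerClassControl → NearMatchedFreeLunchR (1 / 16) 1)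
    (h₃ : BVExpLevelQuarter → BilinearBVHalf → FriableLocalLaw → PlueckerClassControl)
    (h₄ : BVExpLevelQuarter) (h₅ : BilinearBVHalf) (h₆ : FriableLocalLaw) : ¬ TameLocalReceptacle :=
  h₁ (1 / 16) 1 (by norm_num) (by norm_num) (h₂ (h₃ h₄ h₅ h₆))

/-- **Registered skeleton theorem**: concludes the line's typed target BY NAME from the stubs. -/
theorem NotTameLocalReceptacle_of : NotTameLocalReceptacle :=
  notTameLocalReceptacle_of_stubs notTLR_of_nearMatchedR stub_nearMatchedR_of_classControl
    stub_classControl_of_inputs stub_bvExpLevelQuarter stub_bilinearBVHalf stub_friableLocalLaw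

/-- The same, spelled as the negative edge on the route decl (kill criterion (i′)). -/
theorem not_tameLocalReceptacle : ¬ TameLocalReceptacle :=
  NotTameLocalReceptacle_of

end

end Summit.ABC.ABC.Cruxes.ReceptacleIdentity.SplitFriableMargin
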